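import Summits.QuantumAdvantage.QuantumAdvantage.Theorems.CubicForrelationNearExactIsExactCubicFormR4Cells

/-!
# Crux `CubicForrelation.NearExactIsExact` (stmt-QuantumAdvantage-14043) — the cells of an adapted R4 frame, II: their QUADRATIC PARTS

Certificate seat `b2b-cforr-cert` (gen 42).  HONEST FRAMING: kernel-checked bookkeeping (standard axioms), the prefix-`5` analogue of
…CubicFormCells `tcc_second_rho`: for a cubic `κ` on `5 + m` bits the second difference of the cell `ρ_w = κ(w, ·)` (`w ∈ 𝔽₂⁵`) at `0`
along `e_σ, e_τ` — the alternating part `β_w(σ,τ)` of the cell — equals that of `ρ_0` plus `Σ_t w_t · d(e_t, e_{5+σ}, e_{5+τ})` (the gluing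
forms `ι_{e_t} d`; in the R4 frame of …CubicFormR4Partner, `hF` kills the `t = 0` term on `z × z`): R4-PARTNER.md §1 "`β_v = β₀ + L(v)`,
`L(v) = Σ vᵢ Lᵢ`".  Nothing about `θ₁₂`; NOT summit progress.

* `tc5_second_cell`: the second difference of `ρ_w` at `s` along `e_σ, e_τ` is the second difference of `κ` at `(w, s)` along
  `e_{5+σ}, e_{5+τ}` (pure rewriting, any `κ`).
* `tc5_second_rho` (**main**): `S(w, 0) = S(0) ⊕ ⊕_{t<5} w_t·(S(0) ⊕ S(e_t))` for the second difference `S` of a cubic `κ` along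
  `e_{5+σ}, e_{5+τ}` (base-point additivity of second differences of a cubic: the third difference is base-point free, `tcf_third_const`).

References: this seat lineage (g37 R4-PARTNER §1); folklore.  Axioms: the standard three.
-/

set_option linter.dupNamespace false -- D-0017: single-problem summit ⇒ `QuantumAdvantage.QuantumAdvantage` by design

namespace Summit.QuantumAdvantage.QuantumAdvantage.Theorems.CubicForrelation.NearExactIsExact

open Finset
open Literature.Computability.QuantumComplexity
open Literature.Computability.QuantumComplexity.BuzetChailloux (bxor zeroVec bxor_comm bxor_self bxor_zeroVec zeroVec_bxor
  bxor_bxor_cancel_left)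

variable {m : ℕ}

/-- **Second differences of a cell are second differences of `κ`.**  For any `κ` on `5 + m` bits, `w ∈ 𝔽₂⁵`, `s ∈ 𝔽₂ᵐ` and suffix
coordinates `σ, τ`: the second difference of `ρ_w = κ(w, ·)` at `s` along `e_σ, e_τ` is that of `κ` at `(w, s)` along `e_{5+σ}, e_{5+τ}`.
[folklore] -/
theorem tc5_second_cell (κ : (Fin (5 + m) → Bool) → Bool) (w : Fin 5 → Bool) (s : Fin m → Bool) (σ τ : Fin m) :
    ((κ (Fin.append w s) ^^ κ (Fin.append w (bxor s (fun l => decide (l = τ))))) ^^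
        (κ (Fin.append w (bxor s (fun l => decide (l = σ)))) ^^
          κ (Fin.append w (bxor (bxor s (fun l => decide (l = σ))) (fun l => decide (l = τ)))))) =
      ((κ (Fin.append w s) ^^ κ (bxor (Fin.append w s) (fun l => decide (l = Fin.natAdd 5 τ)))) ^^
        (κ (bxor (Fin.append w s) (fun l => decide (l = Fin.natAdd 5 σ))) ^^
          κ (bxor (bxor (Fin.append w s) (fun l => decide (l = Fin.natAdd 5 σ))) (fun l => decide (l = Fin.natAdd 5 τ))))) := by
  have e : ∀ (u : Fin m → Bool) (x : Fin m → Bool), bxor (Fin.append w x) (Fin.append zeroVec u) = Fin.append w (bxor x u) := by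
    intro u x; rw [tc5_append_bxor, bxor_zeroVec]
  rw [tc5_unit_right σ, tc5_unit_right τ]
  simp only [e]

/-- **Quadratic parts of the cells.**  For `deg κ ≤ 3` and suffix coordinates `σ, τ`, with `S(x)` the second difference of `κ` at `x` along
`e_{5+σ}, e_{5+τ}`: `S(w, 0) = S(0) ⊕ w₀·(S(0) ⊕ S(e₀)) ⊕ … ⊕ w₄·(S(0) ⊕ S(e₄))` — the cells' alternating parts differ by the gluing forms
`ι_{e_t} d` (`S(0) ⊕ S(e_t) = [d(e_t, e_{5+σ}, e_{5+τ}) = 1]` by the 3-form law). [this work] -/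
theorem tc5_second_rho (κ : (Fin (5 + m) → Bool) → Bool) (hκ : IsDegLeFun 3 κ) (w : Fin 5 → Bool) (σ τ : Fin m) :
    let S : (Fin (5 + m) → Bool) → Bool := fun x =>
      (κ x ^^ κ (bxor x (fun l => decide (l = Fin.natAdd 5 τ)))) ^^
        (κ (bxor x (fun l => decide (l = Fin.natAdd 5 σ))) ^^
          κ (bxor (bxor x (fun l => decide (l = Fin.natAdd 5 σ))) (fun l => decide (l = Fin.natAdd 5 τ))))
    S (Fin.append w zeroVec) =
      (((((S zeroVec ^^ (w 0 && (S zeroVec ^^ S (bxor zeroVec (fun l => decide (l = Fin.castAdd m (0 : Fin 5))))))) ^^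
              (w 1 && (S zeroVec ^^ S (bxor zeroVec (fun l => decide (l = Fin.castAdd m (1 : Fin 5))))))) ^^
            (w 2 && (S zeroVec ^^ S (bxor zeroVec (fun l => decide (l = Fin.castAdd m (2 : Fin 5))))))) ^^
          (w 3 && (S zeroVec ^^ S (bxor zeroVec (fun l => decide (l = Fin.castAdd m (3 : Fin 5))))))) ^^
        (w 4 && (S zeroVec ^^ S (bxor zeroVec (fun l => decide (l = Fin.castAdd m (4 : Fin 5))))))) := by
  intro S
  -- `S (x ⊕ b•u) = S x ⊕ b•(S 0 ⊕ S (0 ⊕ u))` for cubic `κ` (base-point independence of the third difference)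
  have step : ∀ (b : Bool) (u x : Fin (5 + m) → Bool),
      S (bxor x (fun l => b && u l)) = (S x ^^ (b && (S zeroVec ^^ S (bxor zeroVec u)))) := by
    intro b u x
    have h1 := tcf_third_smul1 κ b u (fun l => decide (l = Fin.natAdd 5 σ)) (fun l => decide (l = Fin.natAdd 5 τ)) x
    have h2 := tcf_third_const κ hκ u (fun l => decide (l = Fin.natAdd 5 σ)) (fun l => decide (l = Fin.natAdd 5 τ)) x zeroVec
    dsimp only [S]
    have key : ∀ A B C : Bool, (A ^^ B) = C → B = (A ^^ C) := by decide
    refine key _ _ _ ?_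
    rw [h1, h2]
  have hv : Fin.append w (zeroVec : Fin m → Bool) =
      bxor (bxor (bxor (bxor (bxor zeroVec (fun l => w 0 && (fun l => decide (l = Fin.castAdd m (0 : Fin 5))) l))
        (fun l => w 1 && (fun l => decide (l = Fin.castAdd m (1 : Fin 5))) l))
        (fun l => w 2 && (fun l => decide (l = Fin.castAdd m (2 : Fin 5))) l))
        (fun l => w 3 && (fun l => decide (l = Fin.castAdd m (3 : Fin 5))) l))
        (fun l => w 4 && (fun l => decide (l = Fin.castAdd m (4 : Fin 5))) l) := by
    rw [tc5_unit_left, tc5_unit_left, tc5_unit_left, tc5_unit_left, tc5_unit_left]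
    funext l
    refine Fin.addCases (fun i => ?_) (fun ρ' => ?_) l
    · simp only [bxor, Fin.append_left, zeroVec]
      fin_cases i <;> simp
    · simp only [bxor, Fin.append_right, zeroVec]
      simp
  rw [hv, step, step, step, step, step]

end Summit.QuantumAdvantage.QuantumAdvantage.Theorems.CubicForrelation.NearExactIsExact
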